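/- Fleet lead `ym-wcr-19456-p1`, route `WeakCouplingRates`, crux `ColdBoxTwoPointFloorW` (stmt-QuantumFields-19608). -/
import Literature.MathematicalPhysics.QuantumLattice.SU2HaarChart
import Literature.MathematicalPhysics.QuantumLattice.SU2HaarSmallBall
import HarnessLib

/-!
# Crux `ColdBoxTwoPointFloor(W)`, piece S3c-ii step 4 (chart), single-link facts: the Wilson cost of `SU(2)` in the GNOMONIC chart

In the gnomonic chart `v ↦ P(1, v) = quatToSU2 (gnomonicQuat v)` of `SU(2)` at the identity (tree `SU2HaarChart.lean`: Haar has density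
`(2π²)⁻¹(1+|v|²)⁻²dv` there, `lintegral_haarProbability_su2_gnomonic`) the single-link Wilson cost is EXACTLY
`2 − Re tr P(1,v) = 2 − 2/√(1+|v|²)` (`two_sub_trace_re_gnomonic`), hence quadratic in the chart coordinate:
`|v|²/(1+|v|²) ≤ 2 − Re tr P(1,v) ≤ |v|²` (`two_sub_trace_re_gnomonic_bounds`, via the scalar `gnomonicCost_bounds`).  Also the
quaternion products behind plaquette variables: `re((1,v)(1,w)) = 1 − v·w` (`re_gnomonicQuat_mul`) and `(1,v)(1,−v) = 1 + |v|²` (real,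
`gnomonicQuat_mul_neg_re/_im`; so a reversed link is the chart point `−v`).  These are the per-link inputs of the sup-norm Taylor
step of stub `stub_boxDirichletDomination`/`stub_boxGaussianDomination` (β·cost ≈ ½|t|² with `t = √(2β)·v`, three colour components).
Everything proved; no definition; standard axioms.
-/

set_option autoImplicit false

noncomputable section

open Quaternion
open Literature.MathematicalPhysics.QuantumLattice

namespace Summit.QuantumFields.YangMills.Theorems.WeakCouplingRates

/-- The norm of the gnomonic quaternion: `‖(1,v)‖ = √(1 + Σ v_i²)`. -/
theorem norm_gnomonicQuat (v : Fin 3 → ℝ) : ‖gnomonicQuat v‖ = Real.sqrt (1 + ∑ i, v i ^ 2) := by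
  rw [← sq_norm_gnomonicQuat, Real.sqrt_sq (norm_nonneg _)]

/-- **The single-link Wilson cost in the gnomonic chart**: `2 − Re tr P(1, v) = 2 − 2/√(1 + |v|²)`. -/
theorem two_sub_trace_re_gnomonic (v : Fin 3 → ℝ) :
    2 - (((quatToSU2 (gnomonicQuat v) : Matrix.specialUnitaryGroup (Fin 2) ℂ) : Matrix (Fin 2) (Fin 2) ℂ).trace).re =
      2 - 2 / Real.sqrt (1 + ∑ i, v i ^ 2) := by
  rw [trace_quatToSU2_re (gnomonicQuat_ne_zero v), norm_gnomonicQuat]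
  simp [gnomonicQuat, div_eq_mul_inv]

/-- The elementary two-sided bound `s/(1+s) ≤ 2 − 2/√(1+s) ≤ s` for `s ≥ 0`. -/
theorem gnomonicCost_bounds {s : ℝ} (hs : 0 ≤ s) :
    s / (1 + s) ≤ 2 - 2 / Real.sqrt (1 + s) ∧ 2 - 2 / Real.sqrt (1 + s) ≤ s := by
  set r := Real.sqrt (1 + s) with hr
  have hr1 : 1 ≤ r := by rw [hr]; exact Real.one_le_sqrt.2 (by linarith)
  have hr0 : 0 < r := by linarith
  have hr2 : r ^ 2 = 1 + s := by rw [hr, Real.sq_sqrt (by linarith)]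
  have hs' : s = r ^ 2 - 1 := by linarith
  have e : (2 : ℝ) - 2 / r = (2 * r - 2) / r := by field_simp
  rw [e]
  constructor
  · rw [hs', show (1 : ℝ) + (r ^ 2 - 1) = r ^ 2 by ring, div_le_div_iff₀ (by positivity) hr0]
    nlinarith [mul_nonneg hr0.le (sq_nonneg (r - 1))]
  · rw [hs', div_le_iff₀ hr0]
    nlinarith [mul_nonneg (sq_nonneg (r - 1)) (by linarith : (0 : ℝ) ≤ r + 2)]

/-- **The single-link cost is quadratic in the chart coordinate**: `|v|²/(1+|v|²) ≤ 2 − Re tr P(1,v) ≤ |v|²`. -/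
theorem two_sub_trace_re_gnomonic_bounds (v : Fin 3 → ℝ) :
    (∑ i, v i ^ 2) / (1 + ∑ i, v i ^ 2) ≤ 2 - (((quatToSU2 (gnomonicQuat v) : Matrix.specialUnitaryGroup (Fin 2) ℂ) : Matrix (Fin 2) (Fin 2) ℂ).trace).re ∧
      2 - (((quatToSU2 (gnomonicQuat v) : Matrix.specialUnitaryGroup (Fin 2) ℂ) : Matrix (Fin 2) (Fin 2) ℂ).trace).re ≤ ∑ i, v i ^ 2 := by
  rw [two_sub_trace_re_gnomonic]
  exact gnomonicCost_bounds (Finset.sum_nonneg fun i _ => sq_nonneg (v i))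

/-- Quaternion product of two gnomonic quaternions: real part `1 − v·w`. -/
theorem re_gnomonicQuat_mul (v w : Fin 3 → ℝ) :
    (gnomonicQuat v * gnomonicQuat w).re = 1 - ∑ i, v i * w i := by
  simp [gnomonicQuat, Quaternion.re_mul, Fin.sum_univ_three]
  ring

/-- `(1, v)(1, −v)` is the REAL quaternion `1 + |v|²` (so the chart inverse of a link is `v ↦ −v` after projection). -/
theorem gnomonicQuat_mul_neg_re (v : Fin 3 → ℝ) :
    (gnomonicQuat v * gnomonicQuat (-v)).re = 1 + ∑ i, v i ^ 2 := by
  rw [re_gnomonicQuat_mul]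
  simp [Fin.sum_univ_three]
  ring

/-- `(1, v)(1, −v)` has no imaginary part. -/
theorem gnomonicQuat_mul_neg_im (v : Fin 3 → ℝ) :
    (gnomonicQuat v * gnomonicQuat (-v)).imI = 0 ∧ (gnomonicQuat v * gnomonicQuat (-v)).imJ = 0 ∧
      (gnomonicQuat v * gnomonicQuat (-v)).imK = 0 := by
  refine ⟨?_, ?_, ?_⟩ <;> simp [gnomonicQuat] <;> ring

end Summit.QuantumFields.YangMills.Theorems.WeakCouplingRates

end
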